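import Summits.ValiantsHypothesis.ValiantsHypothesis.Theses.TwistedDetRank
import Summits.ValiantsHypothesis.ValiantsHypothesis.Theorems.TwistedDetRankTdrPerNotQP
import Summits.ValiantsHypothesis.ValiantsHypothesis.Theorems.TwistedDetRankFermionicNormalFormDefs
import Summits.ValiantsHypothesis.ValiantsHypothesis.Theorems.TwistedDetRankFermionicNormalFormConeGlue
import Summits.ValiantsHypothesis.ValiantsHypothesis.Theorems.TwistedDetRankFermionicNormalFormSummitHard
import Summits.ValiantsHypothesis.ValiantsHypothesis.Theorems.TwistedDetRankFermionicNormalFormLocalGenerators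
import Summits.ValiantsHypothesis.ValiantsHypothesis.Theses.ProofCarryingSymmetry
import Summits.ValiantsHypothesis.ValiantsHypothesis.Theorems.ProofCarryingSymmetrySquareSymmetricPermLB
import Summits.ValiantsHypothesis.ValiantsHypothesis.Theorems.ProofCarryingSymmetryAssembly
import Literature.Computability.AlgebraicComplexity.SymmetricArithCircuit
import Literature.Computability.AlgebraicComplexity.DeterminantalComplexity
import Literature.Computability.AlgebraicComplexity.DeterminantalComplexityProofs
import Literature.Computability.AlgebraicComplexity.PermanentVsDeterminant

/-!
# Crux `TwistedDetRank.SliceVBPFermionic` (stmt-ValiantsHypothesis-17991, X2b) — calibration of the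
# crux and of the two stubs of its registered line `stub_restorationVBP → stub_symmetricFermionic`

X2b ("a class-function GMF family `f_n = Σ_σ χ_n(σ) Π_i X_{σ(i),i}` with affine determinantal
representations of p-bounded size is, for `n ≥ 1`, a sum of quasi-polynomially many Hadamard-twisted
determinants `det(X ∘ E_t)`") is worked here by CALIBRATION, all kernel-checked and unconditional:

* §1 `dcPerSuperpolynomial_of_sliceVBPFermionic` — X2b implies Valiant's determinantal hypothesis
  `DcPerSuperpolynomial ℂ` (`VNP ⊄ VBP`: `dc(per_n)` is not p-bounded), through the PROVED crux X1
  `tdrPerNotQP_proof` (`tdr(per_{3m}) ≥ (3/2)^m`); and `sliceVBPFermionic_iff`: X2b is EQUIVALENT to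
  `DcPerSuperpolynomial ℂ ∧ (DcPerSuperpolynomial ℂ → X2b)` — its provable content beyond Valiant's
  per/det conjecture is exactly the transfer `VNP ⊄ VBP ⟹ X2b`.
* §2 `dcPerSuperpolynomial_of_restorationVBP` — the FIRST stub of the registered skeleton
  (Cruxes/FermionicNormalForm/SplitVBPSkeletonX2b.lean: "a class-function GMF family of p-bounded `dc`
  has `S_n`-symmetric labelled circuits of quasi-polynomial size") ALONE implies
  `DcPerSuperpolynomial ℂ`: under `¬ DcPerSuperpolynomial ℂ` the permanent (the GMF of `χ ≡ 1`) has
  p-bounded `dc`, the stub gives it quasi-polynomial `S_n`-symmetric circuits, and the PROVED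
  Dawar–Wilsenach Theorem 7.1 (`squareSymmetricPermLB_proof`: size `≥ 2^{ε n}` infinitely often)
  forbids that.  So the restoration stub is at least as hard as Valiant's 1979 per/det conjecture.
* §3 `symmetricFermionic_of_symA` — the SECOND stub ("quasi-polynomial `S_n`-symmetric circuits for a
  class-function GMF ⟹ quasi-polynomial tdr for `n ≥ 1`") FOLLOWS from the VH-free statement SymA
  of the parent crux's line `symmetric` ("symmetric-cheap ⟹ quasi-local coefficients",
  Cruxes/FermionicNormalForm/Lines/symmetric.lean) composed with the LANDED construction half B
  (`stub_localGeneratorsSmallTdr`, Theorems/TwistedDetRankFermionicNormalFormLocalGenerators.lean):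
  the second stub carries no content beyond SymA.

Consequence for the line (honest): the director's decomposition X2b ⇐ R_VBP ∘ (SymA ∘ B) has
R_VBP ≥ `VNP ⊄ VBP` (§2) and SymA open and VH-free (its instances `χ ≡ 1` and irreducible `χ^λ` are
theorems: Dawar–Wilsenach 2025 Thm 7.1, in tree; Dawar–Pago–Seppelt 2025 Thm 3.5); nothing here is
progress on `VP ≠ VNP`, which is not moved by this item alone.

References: L. G. Valiant, STOC 1979; T. Mignon, N. Ressayre, IMRN 2004; G. Malod, N. Portier,
J. Complexity 24 (2008); A. Dawar, G. Wilsenach, ToC 21 (2025), Thm 7.1; J. M. Landsberg,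
N. Ressayre, arXiv:1508.05788; P. Bürgisser, *Completeness and Reduction* (2000) §2.5.
No named facts are assumed.
-/

-- single-conjunct layout: Sub = Summit, duplicated namespace component intended
set_option linter.dupNamespace false

noncomputable section

namespace Summit.ValiantsHypothesis.ValiantsHypothesis.Theorems.TwistedDetRankSliceVBPFermionic

open Literature.Computability.AlgebraicComplexity
open Summit.ValiantsHypothesis.ValiantsHypothesis.Theses.TwistedDetRank
open Summit.ValiantsHypothesis.ValiantsHypothesis.Theorems.TwistedDetRankFermionicNormalForm
open scoped BigOperators

/-! ## §1 The crux implies Valiant's determinantal hypothesis -/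

/-- `per_n` is the generalised matrix function of the class function `χ ≡ 1`. [folklore] -/
theorem gmf_one_eq_perPoly (n : ℕ) :
    (∑ σ : Equiv.Perm (Fin n), MvPolynomial.C (1 : ℂ) *
        ∏ i : Fin n, (MvPolynomial.X (σ i, i) : MvPolynomial (Fin n × Fin n) ℂ)) =
      perPoly (Fin n) ℂ := by
  simp [perPoly, Matrix.permanent]

/-- Under `¬ DcPerSuperpolynomial ℂ` the GMF of `χ ≡ 1` satisfies the `dc` hypothesis of X2b
(`hasDetRepr_determinantalComplexity_holds`: the infimum `dc` is attained). [folklore] -/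
theorem hasDetRepr_gmf_one_of_not_dcPerSuperpolynomial (h : ¬ DcPerSuperpolynomial ℂ) :
    ∃ c : ℕ, ∀ n : ℕ, ∃ m ≤ n ^ c + c,
      HasDetRepr (∑ σ : Equiv.Perm (Fin n), MvPolynomial.C (1 : ℂ) *
        ∏ i : Fin n, (MvPolynomial.X (σ i, i) : MvPolynomial (Fin n × Fin n) ℂ)) m := by
  unfold DcPerSuperpolynomial at h
  push Not at h
  obtain ⟨c, hc⟩ := h
  refine ⟨c, fun n => ⟨determinantalComplexity (perPoly (Fin n) ℂ), hc n, ?_⟩⟩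
  rw [gmf_one_eq_perPoly]
  exact hasDetRepr_determinantalComplexity_holds _

/-- **X2b implies `VNP ⊄ VBP` over `ℂ`** (`DcPerSuperpolynomial ℂ`): a p-bounded `dc(per_n)` is a
p-bounded affine representation of the GMF of `χ ≡ 1`, which X2b turns into a quasi-polynomial
twisted representation of `per_n` (`n ≥ 1`; `n = 0`: one empty determinant), contradicting the
proved crux X1 `tdrPerNotQP_proof`.  (Re-landing under `Theorems/` of the strategist's calibration
`Cruxes/FermionicNormalForm/SplitVBP.lean §3`.) [folklore] -/
theorem dcPerSuperpolynomial_of_sliceVBPFermionic :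
    SliceVBPFermionic → DcPerSuperpolynomial ℂ := by
  intro hX2b
  by_contra hpb
  obtain ⟨c', hc'⟩ := hX2b (fun _ _ => (1 : ℂ)) (fun _ _ _ => rfl)
    (hasDetRepr_gmf_one_of_not_dcPerSuperpolynomial hpb)
  apply tdrPerNotQP_proof
  refine ⟨c', fun n => ?_⟩
  rcases Nat.eq_zero_or_pos n with rfl | hn
  · refine ⟨1, Nat.one_le_two_pow, fun _ => 0, ?_⟩
    simp [perPoly, Matrix.permanent_isEmpty, Matrix.det_isEmpty]
  · obtain ⟨r, hr, E, hE⟩ := hc' n hn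
    exact ⟨r, hr, E, (gmf_one_eq_perPoly n).symm.trans hE⟩

/-- **What X2b is, relative to Valiant's per/det conjecture.**  `SliceVBPFermionic` is equivalent to
`DcPerSuperpolynomial ℂ ∧ (DcPerSuperpolynomial ℂ → SliceVBPFermionic)`: any proof of X2b proves
`VNP ⊄ VBP` on the way, and the content of X2b BEYOND that conjecture is exactly the transfer
`VNP ⊄ VBP ⟹ X2b` (pure logic from §1). [folklore] -/
theorem sliceVBPFermionic_iff :
    SliceVBPFermionic ↔ (DcPerSuperpolynomial ℂ ∧ (DcPerSuperpolynomial ℂ → SliceVBPFermionic)) :=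
  ⟨fun h => ⟨dcPerSuperpolynomial_of_sliceVBPFermionic h, fun _ => h⟩, fun h => h.2 h.1⟩

/-! ## §2 The restoration stub of the registered line is at least `VNP ⊄ VBP`-hard -/

/-- **CALIBRATION of `stub_restorationVBP`** (first stub of the registered skeleton of X2b,
`Cruxes/FermionicNormalForm/SplitVBPSkeletonX2b.lean`, statement verbatim as hypothesis): restoration of
`S_n`-symmetry at quasi-polynomial cost on the VBP slice implies `DcPerSuperpolynomial ℂ`.  Under
`¬ DcPerSuperpolynomial ℂ` the GMF of `χ ≡ 1` (= `per_n`) has p-bounded `dc`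
(`hasDetRepr_gmf_one_of_not_dcPerSuperpolynomial`), so the stub gives `S_n`-symmetric circuits for
`per_n` of size `≤ 2^((log₂ n + c)^c)` for every `n`, against the PROVED Dawar–Wilsenach Theorem 7.1
(`squareSymmetricPermLB_proof`: size `≥ 2^{ε n}` for arbitrarily large `n`) and
`(log₂ n + c)^c < ε n` eventually (`natLog_add_pow_lt_mul_eventually`).
[cite: DawarWilsenach2025, Thm. 7.1] -/
theorem dcPerSuperpolynomial_of_restorationVBP
    (hR : ∀ χ : (n : ℕ) → Equiv.Perm (Fin n) → ℂ,
      (∀ (n : ℕ) (σ τ : Equiv.Perm (Fin n)), χ n (τ * σ * τ⁻¹) = χ n σ) →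
      (∃ c : ℕ, ∀ n : ℕ, ∃ m ≤ n ^ c + c,
        HasDetRepr (∑ σ : Equiv.Perm (Fin n),
          MvPolynomial.C (χ n σ) * ∏ i : Fin n, (MvPolynomial.X (σ i, i) : MvPolynomial (Fin n × Fin n) ℂ)) m) →
      ∃ c : ℕ, ∀ n : ℕ, ∃ (G : Type) (_ : Fintype G)
        (C : LabelledArithCircuit ℂ (Fin n × Fin n) Unit G),
        C.IsSymmetric (Equiv.Perm (Fin n)) ∧
        C.eval (C.output ()) = (∑ σ : Equiv.Perm (Fin n),
          MvPolynomial.C (χ n σ) * ∏ i : Fin n, (MvPolynomial.X (σ i, i) : MvPolynomial (Fin n × Fin n) ℂ)) ∧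
        Fintype.card G ≤ 2 ^ ((Nat.log 2 n + c) ^ c)) :
    DcPerSuperpolynomial ℂ := by
  by_contra hpb
  obtain ⟨c, hc⟩ := hR (fun _ _ => (1 : ℂ)) (fun _ _ _ => rfl)
    (hasDetRepr_gmf_one_of_not_dcPerSuperpolynomial hpb)
  choose G hG C hsym heval hcard using hc
  have heval' : ∀ n, (C n).eval ((C n).output ()) = perPoly (Fin n) ℂ := fun n =>
    (heval n).trans (gmf_one_eq_perPoly n)
  have hLB : Summit.ValiantsHypothesis.ValiantsHypothesis.Theses.ProofCarryingSymmetry.SquareSymmetricPermLB :=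
    Summit.ValiantsHypothesis.ValiantsHypothesis.Theorems.squareSymmetricPermLB_proof
  obtain ⟨ε, hε, hio⟩ := @hLB G hG C hsym heval'
  obtain ⟨n₀, hn₀⟩ :=
    Summit.ValiantsHypothesis.Theorems.ProofCarryingSymmetry.natLog_add_pow_lt_mul_eventually c hε
  obtain ⟨n, hn, hle⟩ := hio n₀
  have h1 : (Fintype.card (G n) : ℝ) ≤ (2 : ℝ) ^ (((Nat.log 2 n + c) ^ c : ℕ) : ℝ) := by
    rw [Real.rpow_natCast]
    exact_mod_cast hcard n
  have h2 : ε * n ≤ (((Nat.log 2 n + c) ^ c : ℕ) : ℝ) :=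
    (Real.rpow_le_rpow_left_iff one_lt_two).1 (hle.trans h1)
  exact absurd (hn₀ n hn) (not_lt.2 h2)

/-- Read together with §1: the restoration stub and the crux sit at the same height relative to
`VNP ⊄ VBP` — both imply it; neither is known to follow from it. [folklore] -/
theorem restorationVBP_and_sliceVBPFermionic_imply_dcPerSuperpolynomial
    (h : SliceVBPFermionic ∨
      (∀ χ : (n : ℕ) → Equiv.Perm (Fin n) → ℂ,
        (∀ (n : ℕ) (σ τ : Equiv.Perm (Fin n)), χ n (τ * σ * τ⁻¹) = χ n σ) →
        (∃ c : ℕ, ∀ n : ℕ, ∃ m ≤ n ^ c + c,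
          HasDetRepr (∑ σ : Equiv.Perm (Fin n),
            MvPolynomial.C (χ n σ) * ∏ i : Fin n, (MvPolynomial.X (σ i, i) : MvPolynomial (Fin n × Fin n) ℂ)) m) →
        ∃ c : ℕ, ∀ n : ℕ, ∃ (G : Type) (_ : Fintype G)
          (C : LabelledArithCircuit ℂ (Fin n × Fin n) Unit G),
          C.IsSymmetric (Equiv.Perm (Fin n)) ∧
          C.eval (C.output ()) = (∑ σ : Equiv.Perm (Fin n),
            MvPolynomial.C (χ n σ) * ∏ i : Fin n, (MvPolynomial.X (σ i, i) : MvPolynomial (Fin n × Fin n) ℂ)) ∧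
          Fintype.card G ≤ 2 ^ ((Nat.log 2 n + c) ^ c))) :
    DcPerSuperpolynomial ℂ :=
  h.elim dcPerSuperpolynomial_of_sliceVBPFermionic dcPerSuperpolynomial_of_restorationVBP

/-! ## §3 The second stub of the registered line is SymA ∘ B with B landed -/

/-- Count bookkeeping: with `M = (log₂ n + c₁)^c₁`, `2^M · (n+1)^(M+1) ≤ 2^((log₂ n + c)^c)` for
`c = c₁ + 3` and every `n` (the parent line's absorption lemma, re-proved here). [folklore] -/
theorem qp_mul_absorb (c₁ : ℕ) : ∃ c : ℕ, ∀ n : ℕ,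
    2 ^ ((Nat.log 2 n + c₁) ^ c₁) * (n + 1) ^ ((Nat.log 2 n + c₁) ^ c₁ + 1) ≤
      2 ^ ((Nat.log 2 n + c) ^ c) := by
  refine ⟨c₁ + 3, fun n => ?_⟩
  have hn : n < 2 ^ (Nat.log 2 n + 1) := Nat.lt_pow_succ_log_self Nat.one_lt_two n
  generalize Nat.log 2 n = L at hn ⊢
  set M : ℕ := (L + c₁) ^ c₁ with hM
  set B : ℕ := L + (c₁ + 3) with hB
  have hB1 : 1 ≤ B := by omega
  have hB2 : 2 ≤ B := by omega
  have hMB : M ≤ B ^ c₁ := by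
    rw [hM]; exact Nat.pow_le_pow_left (by omega) _
  have hpow1 : 1 ≤ B ^ c₁ := Nat.one_le_pow _ _ (by omega)
  have hexp : M + (L + 1) * (M + 1) ≤ B ^ (c₁ + 3) :=
    calc M + (L + 1) * (M + 1) ≤ (L + 2) * (M + 1) := by nlinarith
      _ ≤ B * (B ^ c₁ + 1) := Nat.mul_le_mul (by omega) (by omega)
      _ ≤ B * (2 * B ^ c₁) := Nat.mul_le_mul_left _ (by omega)
      _ ≤ B * (B * B ^ c₁) := Nat.mul_le_mul_left _ (Nat.mul_le_mul_right _ hB2)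
      _ = B ^ (c₁ + 2) := by ring
      _ ≤ B ^ (c₁ + 3) := Nat.pow_le_pow_right hB1 (by omega)
  have hbase : (n + 1) ^ (M + 1) ≤ 2 ^ ((L + 1) * (M + 1)) :=
    calc (n + 1) ^ (M + 1) ≤ (2 ^ (L + 1)) ^ (M + 1) := Nat.pow_le_pow_left (by omega) _
      _ = 2 ^ ((L + 1) * (M + 1)) := (pow_mul 2 _ _).symm
  calc 2 ^ M * (n + 1) ^ (M + 1) ≤ 2 ^ M * 2 ^ ((L + 1) * (M + 1)) := Nat.mul_le_mul_left _ hbase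
    _ = 2 ^ (M + (L + 1) * (M + 1)) := (pow_add 2 _ _).symm
    _ ≤ 2 ^ (B ^ (c₁ + 3)) := Nat.pow_le_pow_right (by norm_num) hexp

/-- **Quasi-local coefficients ⇒ few twisted determinants**, from the LANDED construction half B
(`stub_localGeneratorsSmallTdr`): take the quasi-local expansion `χ_n = Σ_{t<r} a_t • g_t`, one
cone sum of length `(n+1)^(M+1)` per generator in coefficient form (`repr_of_gmf_eq`), the linear
combination as one cone sum (`cone_lincomb`, `1 ≤ n`), back to polynomials (`gmf_eq_of_repr`), and
the count `qp_mul_absorb`. [folklore] -/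
theorem smallTdr_of_isQuasiLocal (χ : (n : ℕ) → Equiv.Perm (Fin n) → ℂ) (hq : IsQuasiLocal χ) :
    ∃ c : ℕ, ∀ n : ℕ, 1 ≤ n → ∃ r ≤ 2 ^ ((Nat.log 2 n + c) ^ c),
      ∃ E : Fin r → Matrix (Fin n) (Fin n) ℂ,
        (∑ σ : Equiv.Perm (Fin n), MvPolynomial.C (χ n σ) *
            ∏ i : Fin n, (MvPolynomial.X (σ i, i) : MvPolynomial (Fin n × Fin n) ℂ)) =
          ∑ t, (Matrix.of fun i j => MvPolynomial.C (E t i j) * MvPolynomial.X (i, j)).det := by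
  have hB : LocalGeneratorsSmallTdr := stub_localGeneratorsSmallTdr
  obtain ⟨c₁, hq⟩ := hq
  obtain ⟨c, hc⟩ := qp_mul_absorb c₁
  refine ⟨c, fun n hn => ?_⟩
  obtain ⟨r, hr, a, g, hg, hχ⟩ := hq n hn
  have hcone : ∀ t : Fin r,
      ∃ E : Fin ((n + 1) ^ ((Nat.log 2 n + c₁) ^ c₁ + 1)) → Matrix (Fin n) (Fin n) ℂ,
        ∀ σ : Equiv.Perm (Fin n),
          g t σ = ∑ s, ((Equiv.Perm.sign σ : ℤ) : ℂ) * ∏ i, E s (σ i) i := by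
    intro t
    obtain ⟨E, hE⟩ := hB n ((Nat.log 2 n + c₁) ^ c₁) (g t) hn (hg t)
    exact ⟨E, fun σ => repr_of_gmf_eq (g t) E hE σ⟩
  choose E hE using hcone
  obtain ⟨E', hE'⟩ := cone_lincomb hn a g E hE
  refine ⟨r * (n + 1) ^ ((Nat.log 2 n + c₁) ^ c₁ + 1),
    le_trans (Nat.mul_le_mul_right _ hr) (hc n), E', ?_⟩
  refine gmf_eq_of_repr (χ n) E' fun σ => ?_
  rw [← hE' σ, hχ]
  simp only [Finset.sum_apply, Pi.smul_apply, smul_eq_mul]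

/-- **CALIBRATION of `stub_symmetricFermionic`** (second stub of the registered skeleton of X2b,
statement verbatim as conclusion): it FOLLOWS from SymA of the parent crux's line `symmetric`
("if the GMF family of a class function `χ` has `S_n`-symmetric circuits of size
`≤ 2^((log₂ n + c)^c)` then `χ` is quasi-local", statement verbatim as hypothesis; VH-free, its
`χ ≡ 1` instance is Dawar–Wilsenach Thm 7.1) composed with the landed B
(`smallTdr_of_isQuasiLocal`).  The class-function hypothesis of the stub is not even used.
[cite: DawarWilsenach2025, Thm. 7.1] -/
theorem symmetricFermionic_of_symA
    (hS : ∀ χ : (n : ℕ) → Equiv.Perm (Fin n) → ℂ,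
      (∃ c : ℕ, ∀ n : ℕ, ∃ (G : Type) (_ : Fintype G)
        (C : LabelledArithCircuit ℂ (Fin n × Fin n) Unit G),
        C.IsSymmetric (Equiv.Perm (Fin n)) ∧
        C.eval (C.output ()) = (∑ σ : Equiv.Perm (Fin n), MvPolynomial.C (χ n σ) *
          ∏ i : Fin n, (MvPolynomial.X (σ i, i) : MvPolynomial (Fin n × Fin n) ℂ)) ∧
        Fintype.card G ≤ 2 ^ ((Nat.log 2 n + c) ^ c)) →
      IsQuasiLocal χ) :
    ∀ χ : (n : ℕ) → Equiv.Perm (Fin n) → ℂ,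
      (∀ (n : ℕ) (σ τ : Equiv.Perm (Fin n)), χ n (τ * σ * τ⁻¹) = χ n σ) →
      (∃ c : ℕ, ∀ n : ℕ, ∃ (G : Type) (_ : Fintype G)
        (C : LabelledArithCircuit ℂ (Fin n × Fin n) Unit G),
        C.IsSymmetric (Equiv.Perm (Fin n)) ∧
        C.eval (C.output ()) = (∑ σ : Equiv.Perm (Fin n),
          MvPolynomial.C (χ n σ) * ∏ i : Fin n, (MvPolynomial.X (σ i, i) : MvPolynomial (Fin n × Fin n) ℂ)) ∧
        Fintype.card G ≤ 2 ^ ((Nat.log 2 n + c) ^ c)) →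
      ∃ c : ℕ, ∀ n : ℕ, 1 ≤ n → ∃ r ≤ 2 ^ ((Nat.log 2 n + c) ^ c), ∃ E : Fin r → Matrix (Fin n) (Fin n) ℂ,
        (∑ σ : Equiv.Perm (Fin n), MvPolynomial.C (χ n σ) *
            ∏ i : Fin n, (MvPolynomial.X (σ i, i) : MvPolynomial (Fin n × Fin n) ℂ)) =
          ∑ t, (Matrix.of fun i j => MvPolynomial.C (E t i j) * MvPolynomial.X (i, j)).det :=
  fun χ _ hsym => smallTdr_of_isQuasiLocal χ (hS χ hsym)

/-- **The registered line, calibrated.**  With SymA (VH-free) the crux X2b reduces to the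
restoration stub alone; and the restoration stub is at least `VNP ⊄ VBP`-hard (§2).  Recorded as
one implication: SymA → (restoration stub → X2b). [folklore] -/
theorem sliceVBPFermionic_of_symA_of_restorationVBP
    (hS : ∀ χ : (n : ℕ) → Equiv.Perm (Fin n) → ℂ,
      (∃ c : ℕ, ∀ n : ℕ, ∃ (G : Type) (_ : Fintype G)
        (C : LabelledArithCircuit ℂ (Fin n × Fin n) Unit G),
        C.IsSymmetric (Equiv.Perm (Fin n)) ∧
        C.eval (C.output ()) = (∑ σ : Equiv.Perm (Fin n), MvPolynomial.C (χ n σ) *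
          ∏ i : Fin n, (MvPolynomial.X (σ i, i) : MvPolynomial (Fin n × Fin n) ℂ)) ∧
        Fintype.card G ≤ 2 ^ ((Nat.log 2 n + c) ^ c)) →
      IsQuasiLocal χ)
    (hR : ∀ χ : (n : ℕ) → Equiv.Perm (Fin n) → ℂ,
      (∀ (n : ℕ) (σ τ : Equiv.Perm (Fin n)), χ n (τ * σ * τ⁻¹) = χ n σ) →
      (∃ c : ℕ, ∀ n : ℕ, ∃ m ≤ n ^ c + c,
        HasDetRepr (∑ σ : Equiv.Perm (Fin n),
          MvPolynomial.C (χ n σ) * ∏ i : Fin n, (MvPolynomial.X (σ i, i) : MvPolynomial (Fin n × Fin n) ℂ)) m) →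
      ∃ c : ℕ, ∀ n : ℕ, ∃ (G : Type) (_ : Fintype G)
        (C : LabelledArithCircuit ℂ (Fin n × Fin n) Unit G),
        C.IsSymmetric (Equiv.Perm (Fin n)) ∧
        C.eval (C.output ()) = (∑ σ : Equiv.Perm (Fin n),
          MvPolynomial.C (χ n σ) * ∏ i : Fin n, (MvPolynomial.X (σ i, i) : MvPolynomial (Fin n × Fin n) ℂ)) ∧
        Fintype.card G ≤ 2 ^ ((Nat.log 2 n + c) ^ c)) :
    SliceVBPFermionic :=
  fun χ hχ hdc => symmetricFermionic_of_symA hS χ hχ (hR χ hχ hdc)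

end Summit.ValiantsHypothesis.ValiantsHypothesis.Theorems.TwistedDetRankSliceVBPFermionic

end
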